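import Summits.BirchSwinnertonDyer.Rank1Residual.O6.X4ShaTransport
import HarnessLib

/-!
# O6 (wild additive `p = 3`), GEN 23 — T-X4-ШT, §3–§4: the LOWER-half socket, the END over `ℚ`, and the SIX-KINDS form
# (the Selmer-companion count read in the LOWER direction; cell `b2b-bsdres`, unit `b2b-bsdres-o6-r1`; continuation of
# `O6/X4ShaTransport.lean`, split for `lint.size` by the typer of record cc-typer-5 GEN 16)

HONEST FRAMING (run/shared/lean/b2b/bsd-rank1-residual/, verbatim in every file): the goal of the
cell is to DELETE the COMBINATION-SHAPED residual classes of the Birch–Swinnerton-Dyer formula for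
ALL analytic-rank `≤ 1` elliptic curves over `ℚ` — "full BSD formula for every rank `≤ 1` curve in
class `C`" assembled STRICTLY from published theorems — so that the rank-`≤ 1` remainder becomes
exactly the CONSTRUCTION-SHAPED classes, which are TYPED (missing-input `Prop`s), NOT attempted.
This is not "finishing BSD". CLASS-OWNERS.md: research routes; NO CLAIM BEYOND STATED CLASSES.
THEOREMS ONLY (no definition, no named fact, no `sorry`); EVIDENCE seat — nothing is booked by this
file, no label moves, no RESIDUAL-MAP mark moves. Every theorem is CONDITIONAL on the named PUBLISHED
facts in its binders (Cassels–Tate `hCT`, Gross–Zagier–Kolyvagin `hGZK`, modularity `hmod`, Kato 2004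
Thm. 14.5 (3) `hKato`, Tate uniformisation `hU` / `hU2`, the local Euler–Poincaré characteristic `hEP`)
and on the per-pair finite inputs it names.

TYPER'S RECORD (cc-typer-5 GEN 16; docket cc-lead ⟦gen61⟧ (2′)(iv′) (c26), routed BY NAME by o6-r1 GEN 23, HOME/INBOX.md l.12009 /
l.12099): source = the FROZEN theorems-only file `HOME/b2b-bsdres-o6-r1/gen23/lean/O6X4ShaTransport.lean` (sha256 `e561bc76d775eb33…`,
636 l. / 14 decls; `SHA256SUMS.gen23` stanza 2 FINAL), source lines 312–634 = §3 + §4 (7 decls) placed here byte for byte; the module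
text "What this file proves", the references and the full typer's record (audit words lit-kato AUD-21 (a)–(d) PASS, census words C-ШT-0
/ C-ШT-1 of record, NIT N-9, DEDUP, PRESEARCH) are in `O6/X4ShaTransport.lean` and apply verbatim.  WHAT IS HERE: §3
`RankZero.missingLowerBoundAt_of_congr_of_shaPartner` (crude LOWER-half socket, `A(ℚ_v)[p] = 0` on `S`),
`RankZero.missingLowerBoundAt_of_congr_of_shaPartner_of_le_off` (refined, lossy `T ⊆ S`), the END
`X4RankZero.bsdp_of_congr_of_shaPartner_of_kato` (X4 ∧ `r_an = 0` ∧ potentially good at odd `p`: Kato's UPPER half + a BSD-decided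
rank-0 Ш-partner — the twin of `Additive.X4RankZero.bsdp_of_congr_of_rank_two_of_kato` with the partner's RANK replaced by the
partner's Ш) and its prime-list form; §4 `exists_sha_ne_zero_of_natCard_selmerGroup_le_mul` (extraction),
`RankZero.missingLowerBoundAt_of_congr_of_shaPartner_six_kinds`, the END `X4RankZero.bsdp_of_congr_of_shaPartner_of_kato_six_kinds`
(census C-ШT-1 / P-ШT-6k: 249 / 1 277 CORE targets carry a complete certificate-verified instance = CANDIDATES, EVIDENCE; nothing
booked; O6 OPEN).  `@[conjecture]` × 0; 0 definitions; 0 Literature facts.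

## References (as in `O6/X4ShaTransport.lean`)

* [MazurRubin2004] B. Mazur, K. Rubin, *Kolyvagin systems*, Mem. AMS 799 (2004), §2.3 (provenance of the PROVED count
  `X11a.SelmerCompanion.natCard_selmerGroup_le_of_congr[_of_le_off]`; lit-kato N-9 / o6-r1 GEN 24 §6 intended locators, doc-only:
  Mazur–Rubin, Invent. Math. 181 (2010) Lemma 3.2 [MazurRubin2010]; Mazur–Rubin, *Selmer companion curves*, Trans. AMS 367 (2015)
  Thm. 3.1 / §7.3 (arXiv:1203.0620)).
* [CremonaMazur2000] J. E. Cremona, B. Mazur, Experiment. Math. 9 (2000), §3.  [Kato2004Asterisque] K. Kato, Astérisque 295 (2004),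
  Thm. 14.5 (3) (p. 236), Prop. 14.16 (2) (p. 244) (`hKato` = A161; N-10 locator, doc-only).  [SilvermanAEC2009] Thm. X.4.2, X.4.14, VII.5 Prop. 5.1(a).  [SilvermanATAEC1994] Ch. V
  Thm. 3.1, Lemma 5.2, Thm. 5.3, Cor. 5.4 (`hU`, `hU2` = A41).  [GreenbergLNM1716] §2 Props. 2.2, 2.4.  [MilneADT2006] Ch. I §2
  Thm. 2.8, Prop. 3.8.  [Miller2011LMS] §1, Def. 1.1.  [Dokchitser2013ParityNotes] §2.  [Mazur1977] Ch. III §5, p. 157.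
* HOME/b2b-bsdres-o6-r1/gen23/O6-GEN23.md §2–§3 (this gen's memo; census C-ШT-0 / C-ШT-1).
-/

set_option autoImplicit false

noncomputable section

open scoped Classical

open WeierstrassCurve Literature.NumberTheory.EllipticCurves
  Literature.NumberTheory.EllipticCurves.ModularForms
  Literature.NumberTheory.EllipticCurves.Rank1Residual
  Literature.NumberTheory.EllipticCurves.Rank1Residual.Typed
  Literature.NumberTheory.GaloisRepresentations Field NumberField IsDedekindDomain

namespace Summit.BirchSwinnertonDyer.Rank1Residual.O6

/-! ### §3. The LOWER-half socket and the END over `ℚ` -/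

section Rat

variable (W : WeierstrassCurve ℚ) [W.IsElliptic] (p : ℕ) [Fact p.Prime]

/-- **T-X4-ШT, LOWER half — Ш-transport from a BSD-decided rank-`0` partner (crude form).** `E = W`
of analytic rank `0` with `E[p]` irreducible and `#Ш_an(E) = q`, `ord_p q ≤ 2`; a partner `A` with a
`Γ_ℚ`-isomorphism `θ : A[p] ≃ E[p]`, `BSD(A,p)`, `r_an(A) = 0`, `#Ш_an(A) = q_A` with `ord_p q_A > 0`;
`S` a finite set of finite places outside which both curves are good and `v ∤ p`, with
`A(ℚ_v)[p] = 0` for every `v ∈ S`. Then `MissingLowerBoundAt W p` (`ord_p #Ш_an(E) ≤ ord_p #Ш(E)`):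
`p < #Sel^(p)(A)` (§2) and the crude count (§1, `p^{[ℚ:ℚ]} = p`) give `Ш(E)[p] ≠ 0`, and
Cassels–Tate gives `p² ∣ #Ш(E)` (`RankZero.missingLowerBoundAt_of_exists_sha_torsion`). NO hypothesis
on the reduction of `E` or `A` at `p`. [cite: MazurRubin2004, §2.3] [cite: CremonaMazur2000, §3]
[cite: SilvermanAEC2009, Thm. X.4.14] [cite: Miller2011LMS, §1 and Def. 1.1] -/
theorem RankZero.missingLowerBoundAt_of_congr_of_shaPartner
    (hCT : exists_casselsTate_pairing (K := ℚ))
    (hGZK : rank_eq_analyticRank_of_analyticRank_le_one) (hp : p ≠ 2)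
    (hr : W.analyticRank = 0) (hirr : W.HasIrreducibleModPGaloisRep p)
    {q : ℚ} (hq : shaAn W = (q : ℂ)) (hv : padicValRat p q ≤ 2)
    (A : WeierstrassCurve ℚ) [A.IsElliptic]
    (θ : geomTorsion A (p : ℤ) ≃+ geomTorsion W (p : ℤ))
    (hθ : ∀ (σ : absoluteGaloisGroup ℚ) (P : geomTorsion A (p : ℤ)), θ (σ • P) = σ • θ P)
    (hbsdA : BSDp A p) (hrA : A.analyticRank = 0) {qA : ℚ} (hqA : shaAn A = (qA : ℂ))
    (hvA : 0 < padicValRat p qA) (S : Finset (HeightOneSpectrum (𝓞 ℚ)))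
    (hS : ∀ v : HeightOneSpectrum (𝓞 ℚ), v ∉ S →
      W.HasGoodReductionAt v ∧ A.HasGoodReductionAt v ∧ (p : 𝓞 ℚ) ∉ v.asIdeal)
    (hloc : ∀ v ∈ S, Nat.card (nsmulAddMonoidHom p :
      (A.baseChange (v.adicCompletion ℚ)).toAffine.Point →+ _).ker = 1) :
    MissingLowerBoundAt W p := by
  haveI : Finite W.toAffine.Point := finite_point_of_analyticRank_eq_zero W hGZK hr
  have hirrA : A.HasIrreducibleModPGaloisRep p :=
    Mazur1978.hasIrreducibleModPGaloisRep_of_addEquiv θ.symm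
      (addEquiv_symm_smul_of_equivariant' A p θ hθ) hirr
  have hSelA := lt_natCard_selmerGroup_of_bsdp_of_padicValRat_pos A p hCT hirrA hbsdA hrA hqA hvA
  have hlt : p ^ Module.finrank ℚ ℚ < Nat.card (A.selmerGroup (p : ℤ)) := by
    rwa [Module.finrank_self, pow_one]
  exact Additive.RankZero.missingLowerBoundAt_of_exists_sha_torsion W p hCT hGZK hr hq hv
    (exists_sha_ne_zero_of_congr_of_pow_lt_natCard_selmerGroup W A hp θ hθ S hS
      (coprime_natCard_point_of_irr W p hirr) hloc hlt)

/-- **T-X4-ШT, LOWER half — refined form with a lossy subset `T ⊆ S`.** As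
`RankZero.missingLowerBoundAt_of_congr_of_shaPartner`, but the local conditions are only required to
AGREE along `θ` at the places of `S \ T` (`θ_* 𝓢_v(A) ≤ 𝓢_v(E)`: discharged by the tree's kind
lemmas — `A(ℚ_v)[p] = 0` off `p`; both split multiplicative with `#E(ℚ_v)[p] ≤ p` [Tate]; both
multiplicative of the same twist type with `μ_p(ℚ_v) = 1` [twisted Tate]; `E` good and `A` non-split
multiplicative), and the budget of the lossy places is `∏_{v∈T} #𝓛_v(A) ≤ p` (e.g. `T = {p}` with
`A(ℚ_p)[p] = 0`: `#𝓛_p(A) = #A(ℚ_p)[p] · #(ℤ_p/p) = p`). [cite: MazurRubin2004, §2.3]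
[cite: SilvermanATAEC1994, Ch. V Thm. 3.1, Thm. 5.3] [cite: Miller2011LMS, §1 and Def. 1.1] -/
theorem RankZero.missingLowerBoundAt_of_congr_of_shaPartner_of_le_off
    (hCT : exists_casselsTate_pairing (K := ℚ))
    (hGZK : rank_eq_analyticRank_of_analyticRank_le_one) (hp : p ≠ 2)
    (hr : W.analyticRank = 0) (hirr : W.HasIrreducibleModPGaloisRep p)
    {q : ℚ} (hq : shaAn W = (q : ℂ)) (hv : padicValRat p q ≤ 2)
    (A : WeierstrassCurve ℚ) [A.IsElliptic]
    (θ : geomTorsion A (p : ℤ) ≃+ geomTorsion W (p : ℤ))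
    (hθ : ∀ (σ : absoluteGaloisGroup ℚ) (P : geomTorsion A (p : ℤ)), θ (σ • P) = σ • θ P)
    (hbsdA : BSDp A p) (hrA : A.analyticRank = 0) {qA : ℚ} (hqA : shaAn A = (qA : ℂ))
    (hvA : 0 < padicValRat p qA) (S T : Finset (HeightOneSpectrum (𝓞 ℚ))) (hTS : T ⊆ S)
    (hS : ∀ v : HeightOneSpectrum (𝓞 ℚ), v ∉ S →
      W.HasGoodReductionAt v ∧ A.HasGoodReductionAt v ∧ (p : 𝓞 ℚ) ∉ v.asIdeal)
    (hagree : ∀ v ∈ S, v ∉ T → ∀ c ∈ selmerLocalKer A (v.adicCompletion ℚ) (p : ℤ),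
      h1Equiv θ hθ c ∈ selmerLocalKer W (v.adicCompletion ℚ) (p : ℤ))
    (hbudget : ∏ v ∈ T, Nat.card (A.kummerLocalConditionAt (p : ℤ) (v.adicCompletion ℚ)) ≤ p) :
    MissingLowerBoundAt W p := by
  haveI : Finite W.toAffine.Point := finite_point_of_analyticRank_eq_zero W hGZK hr
  have hirrA : A.HasIrreducibleModPGaloisRep p :=
    Mazur1978.hasIrreducibleModPGaloisRep_of_addEquiv θ.symm
      (addEquiv_symm_smul_of_equivariant' A p θ hθ) hirr
  have hSelA := lt_natCard_selmerGroup_of_bsdp_of_padicValRat_pos A p hCT hirrA hbsdA hrA hqA hvA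
  exact Additive.RankZero.missingLowerBoundAt_of_exists_sha_torsion W p hCT hGZK hr hq hv
    (exists_sha_ne_zero_of_congr_of_lt_natCard_selmerGroup W A hp θ hθ S T hTS hS hagree
      (coprime_natCard_point_of_irr W p hirr) (hbudget.trans_lt hSelA))

/-- **T-X4-ШT, the END — `BSD(E,p)` on X4 ∧ `r_an = 0` ∧ potentially good at an odd `p`, from
Kato's UPPER half and a BSD-decided rank-`0` Ш-partner.** Binders: the PUBLISHED facts `hKato` (Kato
2004 Thm. 14.5 (3) + Prop. 14.16 (2)), `hCT`, `hGZK`, `hmod`; per pair `r_an(E) = 0`, class X4 at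
`p`, `ord_p j(E) ≥ 0`, `ρ̄_{E,p^n}` onto for all `n`, `p ∤ ∏ c_ℓ(E)`, a parametrisation datum with
`p ∤ c_D`, `#Ш_an(E) = q` with `ord_p q ≤ 2`; per partner `θ : A[p] ≃ E[p]`, `BSD(A,p)`, `r_an(A) = 0`,
`ord_p #Ш_an(A) > 0`, `A(ℚ_v)[p] = 0` on `S`. The exact twin of
`X4RankZero.bsdp_of_congr_of_rank_two_of_kato` with the partner's RANK replaced by the partner's Ш.
At `p = 3` on the wild O6 core this is T-X4-ШT of o6-r1 GEN 23 (census instrument C-ШT-0).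
[cite: Kato2004Asterisque, Thm. 14.5 (3) (p. 236)] [cite: MazurRubin2004, §2.3]
[cite: SilvermanAEC2009, Thm. X.4.14] [cite: Miller2011LMS, §1 and Def. 1.1] -/
theorem X4RankZero.bsdp_of_congr_of_shaPartner_of_kato
    (hKato : Kato2004.rankZero_padicValNat_sha_le_of_additive_potGood_of_imageContainsSL2)
    (hCT : exists_casselsTate_pairing (K := ℚ))
    (hGZK : rank_eq_analyticRank_of_analyticRank_le_one) (hmod : hasEntireLFunction_rat)
    [W.IsGloballyMinimal] (hp : p ≠ 2)
    (hr : W.analyticRank = 0) (hX : ClassX4 W p) (hpot : 0 ≤ padicValRat p W.j)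
    (hsurj : ∀ n : ℕ, W.HasSurjectiveModNGaloisRep (p ^ n : ℕ)) (htam : ¬ p ∣ W.tamagawaProduct)
    {N : ℕ} [NeZero N] (D : ModularParametrizationData W N) (hc : ¬ (p : ℤ) ∣ D.maninConstant)
    {q : ℚ} (hq : shaAn W = (q : ℂ)) (hv : padicValRat p q ≤ 2)
    (A : WeierstrassCurve ℚ) [A.IsElliptic]
    (θ : geomTorsion A (p : ℤ) ≃+ geomTorsion W (p : ℤ))
    (hθ : ∀ (σ : absoluteGaloisGroup ℚ) (P : geomTorsion A (p : ℤ)), θ (σ • P) = σ • θ P)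
    (hbsdA : BSDp A p) (hrA : A.analyticRank = 0) {qA : ℚ} (hqA : shaAn A = (qA : ℂ))
    (hvA : 0 < padicValRat p qA) (S : Finset (HeightOneSpectrum (𝓞 ℚ)))
    (hS : ∀ v : HeightOneSpectrum (𝓞 ℚ), v ∉ S →
      W.HasGoodReductionAt v ∧ A.HasGoodReductionAt v ∧ (p : 𝓞 ℚ) ∉ v.asIdeal)
    (hloc : ∀ v ∈ S, Nat.card (nsmulAddMonoidHom p :
      (A.baseChange (v.adicCompletion ℚ)).toAffine.Point →+ _).ker = 1) :
    BSDp W p := by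
  have hirr : W.HasIrreducibleModPGaloisRep p :=
    hasIrreducibleModPGaloisRep_of_hasSurjectiveModNGaloisRep W p (by simpa using hsurj 1)
  exact Additive.X4RankZero.bsdp_of_missingLowerBoundAt_of_kato W p hKato hGZK hmod hr hX hpot hsurj
    htam D hc
    (RankZero.missingLowerBoundAt_of_congr_of_shaPartner W p hCT hGZK hp hr hirr hq hv A θ hθ hbsdA
      hrA hqA hvA S hS hloc)

/-- **The prime-list form of the END** (`S` = the places over a list `L ∋ p` supporting both integral
discriminants; the census shape: `L` = the primes of `N_E · N_A · p`).
[cite: SilvermanAEC2009, VII.5 Prop. 5.1(a)] [cite: MazurRubin2004, §2.3] [cite: Miller2011LMS, §1 and Def. 1.1] -/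
theorem X4RankZero.bsdp_of_congr_of_shaPartner_of_kato_of_primeList
    (hKato : Kato2004.rankZero_padicValNat_sha_le_of_additive_potGood_of_imageContainsSL2)
    (hCT : exists_casselsTate_pairing (K := ℚ))
    (hGZK : rank_eq_analyticRank_of_analyticRank_le_one) (hmod : hasEntireLFunction_rat)
    [W.IsGloballyMinimal] (hp : p ≠ 2)
    (hr : W.analyticRank = 0) (hX : ClassX4 W p) (hpot : 0 ≤ padicValRat p W.j)
    (hsurj : ∀ n : ℕ, W.HasSurjectiveModNGaloisRep (p ^ n : ℕ)) (htam : ¬ p ∣ W.tamagawaProduct)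
    {N : ℕ} [NeZero N] (D : ModularParametrizationData W N) (hc : ¬ (p : ℤ) ∣ D.maninConstant)
    {q : ℚ} (hq : shaAn W = (q : ℂ)) (hv : padicValRat p q ≤ 2)
    (A : WeierstrassCurve ℚ) [A.IsElliptic]
    (θ : geomTorsion A (p : ℤ) ≃+ geomTorsion W (p : ℤ))
    (hθ : ∀ (σ : absoluteGaloisGroup ℚ) (P : geomTorsion A (p : ℤ)), θ (σ • P) = σ • θ P)
    (hbsdA : BSDp A p) (hrA : A.analyticRank = 0) {qA : ℚ} (hqA : shaAn A = (qA : ℂ))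
    (hvA : 0 < padicValRat p qA)
    {E₀ F₀ : WeierstrassCurve ℤ} (hE : E₀.map (Int.castRingHom ℚ) = W)
    (hF : F₀.map (Int.castRingHom ℚ) = A) (L : List ℕ) (hpL : p ∈ L)
    (hΔE : ∀ q : ℕ, q.Prime → (q : ℤ) ∣ E₀.Δ → q ∈ L)
    (hΔF : ∀ q : ℕ, q.Prime → (q : ℤ) ∣ F₀.Δ → q ∈ L)
    (hloc : ∀ v : HeightOneSpectrum (𝓞 ℚ), (Rat.HeightOneSpectrum.primesEquiv v : ℕ) ∈ L →
      Nat.card (nsmulAddMonoidHom p :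
        (A.baseChange (v.adicCompletion ℚ)).toAffine.Point →+ _).ker = 1) :
    BSDp W p := by
  obtain ⟨S, hS⟩ := Additive.exists_placeFinset_of_primeList L
  exact X4RankZero.bsdp_of_congr_of_shaPartner_of_kato W p hKato hCT hGZK hmod hp hr hX hpot hsurj htam
    D hc hq hv A θ hθ hbsdA hrA hqA hvA S
    (Additive.good_and_not_mem_of_not_mem_placeFinset hE hF L (Fact.out : p.Prime) hpL hΔE hΔF hS)
    (fun v hvS ↦ hloc v ((hS v).mp hvS))

end Rat

/-! ### §4. The SIX-KINDS form (census C-ШT-1): the agreement off `T` discharged by the tree's six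
kinds of places (`X11a.SelmerCompanion.natCard_selmerGroup_le_of_congr_of_six_kinds_rat`, read
DOWNWARD — the PARTNER `A` is the curve whose Selmer group is bounded, so the kinds are the tree's
with the roles of the two curves exchanged). -/

section Extraction

variable {K : Type} [Field K] [NumberField K] (W : WeierstrassCurve K) [W.IsElliptic]
  (p : ℕ) [Fact p.Prime]

/-- **Extraction** (any number field `K`; stated generically so that the instance paths at `K = ℚ`
unify by application, as in §1). `#Sel^(p)(A) ≤ #Sel^(p)(E) · B` and `B < #Sel^(p)(A)` with `E(K)`
finite of order prime to `p` give a non-zero element of `Ш(E/K)[p]` (`E = W`; here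
`#Sel^(p)(E) = #Ш(E)[p]`). [cite: MazurRubin2004, §2.3] [cite: SilvermanAEC2009, Thm. X.4.2] -/
theorem exists_sha_ne_zero_of_natCard_selmerGroup_le_mul {A : WeierstrassCurve K} [A.IsElliptic]
    {B : ℕ} (hle : Nat.card (A.selmerGroup (p : ℤ)) ≤ Nat.card (W.selmerGroup (p : ℤ)) * B)
    (hlt : B < Nat.card (A.selmerGroup (p : ℤ)))
    [Finite W.toAffine.Point] (hcop : (Nat.card W.toAffine.Point).Coprime p) :
    ∃ c : W.sha, c ≠ 0 ∧ p • c = 0 := by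
  have hp : p.Prime := Fact.out
  -- `#Sel^(p)(E) > 1`
  have hone : 1 < Nat.card (W.selmerGroup (p : ℤ)) := by
    by_contra h
    push Not at h
    have h' := hle.trans (Nat.mul_le_mul_right _ h)
    rw [one_mul] at h'
    exact absurd (hlt.trans_le h') (lt_irrefl _)
  -- `#Sel^(p)(E) = #Ш(E)[p]`
  have hSel := W.natCard_selmerGroup_eq hp.ne_zero
  rw [W.mordellWeilRank_eq_zero_of_finite, pow_zero, one_mul, natCard_torsionBy_eq_one_of_coprime hcop,
    one_mul] at hSel
  rw [hSel] at hone
  haveI : Finite (W.sha ⊓ AddSubgroup.torsionBy W.galH1 (p : ℤ) : AddSubgroup W.galH1) :=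
    Nat.finite_of_card_ne_zero (by omega)
  obtain ⟨x, hx⟩ := AddSubgroup.ne_bot_iff_exists_ne_zero.mp
    ((AddSubgroup.one_lt_card_iff_ne_bot _).mp hone)
  refine ⟨⟨(x : W.galH1), (AddSubgroup.mem_inf.mp x.2).1⟩, fun h0 ↦ hx ?_, ?_⟩
  · have h1 : (x : W.galH1) = 0 := congrArg Subtype.val h0
    exact Subtype.ext (h1.trans (ZeroMemClass.coe_zero _).symm)
  · have hpx : p • (x : W.galH1) = 0 :=
      AddSubgroup.torsionBy.nsmul_iff.mp (AddSubgroup.mem_inf.mp x.2).2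
    apply Subtype.ext
    rw [AddSubgroupClass.coe_nsmul, ZeroMemClass.coe_zero]
    exact hpx

end Extraction

section SixKinds

variable (W : WeierstrassCurve ℚ) [W.IsElliptic] (p : ℕ) [Fact p.Prime]

/-- **T-X4-ШT-6k, LOWER half — Ш-transport with the SIX KINDS of agreement places.** `E = W` and the
partner `A` globally minimal, `p` odd, `r_an(E) = 0`, `E[p]` irreducible, `#Ш_an(E) = q` with
`ord_p q ≤ 2`; `θ : A[p] ≃ E[p]` `Γ_ℚ`-equivariant, `BSD(A,p)`, `r_an(A) = 0`, `ord_p #Ш_an(A) > 0`;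
`S ⊇ T` finite with both curves good and `v ∤ p` outside `S`; every `v ∈ S \ T` of one of the tree's
six kinds READ DOWNWARD (the partner is the bounded curve): (i) `v ∤ p ∧ A(ℚ_v)[p] = 0`; (ii) both
split multiplicative with `#E(ℚ_v)[p] ≤ p`; (iii) both multiplicative of the same twist class with
`μ_p(ℚ_v) = 1`; (iv) `v = ℓ` odd, `ℓ ≠ p`, `A` non-split multiplicative and `E` good at `ℓ`; (v) `v ∣ p`,
`A` non-split multiplicative and `E` good at `p`; (vi) `v = ℓ` odd, `ℓ ≠ p`, `A` good and `E` non-split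
multiplicative at `ℓ`; and the lossy budget `∏_{v ∈ T} #A(ℚ_v)[p] · #(ℤ_v/p) ≤ p` (e.g. `T = {p}` with
`A(ℚ_p)[p] = 0`). Then `MissingLowerBoundAt E p`: `#Sel_p(E) ≥ #Sel_p(A)/p ≥ p²/p > 1`. Binders
`hU`, `hU2` (Tate uniformisation, [Sil94] V.5.3/5.4) and `hEP` (Tate's local Euler characteristic;
a theorem in the tree, `GaloisImage.forall_localEulerPoincareCharacteristic_adicCompletion`) are the
six-kinds count's. Census instrument: o6-r1 GEN 23 C-ШT-1 (kinds per place from reduction types,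
`t_ℓ`, `ℓ mod 3`). [cite: MazurRubin2004, §2.3] [cite: SilvermanATAEC1994, Ch. V Thm. 3.1, Lemma 5.2,
Thm. 5.3, Cor. 5.4, Ex. 5.11] [cite: GreenbergLNM1716, §2 Props. 2.2, 2.4]
[cite: MilneADT2006, Ch. I §2 Thm. 2.8, Prop. 3.8] [cite: Miller2011LMS, §1 and Def. 1.1] -/
theorem RankZero.missingLowerBoundAt_of_congr_of_shaPartner_six_kinds [W.IsGloballyMinimal]
    (hCT : exists_casselsTate_pairing (K := ℚ))
    (hGZK : rank_eq_analyticRank_of_analyticRank_le_one)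
    (hU : Silverman1994_thmV53_tateUniformisation.{0})
    (hU2 : Silverman1994_thmV53_corV54_tateUniformisation.{0})
    (hEP : ∀ v : HeightOneSpectrum (𝓞 ℚ), (p : 𝓞 ℚ) ∈ v.asIdeal →
      localEulerPoincareCharacteristic (v.adicCompletion ℚ)) (hp : p ≠ 2)
    (hr : W.analyticRank = 0) (hirr : W.HasIrreducibleModPGaloisRep p)
    {q : ℚ} (hq : shaAn W = (q : ℂ)) (hv : padicValRat p q ≤ 2)
    (A : WeierstrassCurve ℚ) [A.IsElliptic] [A.IsGloballyMinimal]
    (θ : geomTorsion A (p : ℤ) ≃+ geomTorsion W (p : ℤ))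
    (hθ : ∀ (σ : absoluteGaloisGroup ℚ) (P : geomTorsion A (p : ℤ)), θ (σ • P) = σ • θ P)
    (hbsdA : BSDp A p) (hrA : A.analyticRank = 0) {qA : ℚ} (hqA : shaAn A = (qA : ℂ))
    (hvA : 0 < padicValRat p qA) (S T : Finset (HeightOneSpectrum (𝓞 ℚ))) (hTS : T ⊆ S)
    (hS : ∀ v : HeightOneSpectrum (𝓞 ℚ), v ∉ S →
      W.HasGoodReductionAt v ∧ A.HasGoodReductionAt v ∧ (p : 𝓞 ℚ) ∉ v.asIdeal)
    (hplaces : ∀ v ∈ S, v ∉ T →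
      ((p : 𝓞 ℚ) ∉ v.asIdeal ∧ Nat.card (nsmulAddMonoidHom p :
          (A.baseChange (v.adicCompletion ℚ)).toAffine.Point →+ _).ker = 1) ∨
      (W.HasSplitMultiplicativeReductionAt v ∧ A.HasSplitMultiplicativeReductionAt v ∧
        Nat.card (nsmulAddMonoidHom p :
          (W.baseChange (v.adicCompletion ℚ)).toAffine.Point →+ _).ker ≤ p) ∨
      (W.HasMultiplicativeReductionAt v ∧ A.HasMultiplicativeReductionAt v ∧
        (∃ r : v.adicCompletion ℚ, algebraMap ℚ (v.adicCompletion ℚ) (-(W.c₄ / W.c₆)) =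
          r ^ 2 * algebraMap ℚ (v.adicCompletion ℚ) (-(A.c₄ / A.c₆))) ∧
        (∀ ζ : v.adicCompletion ℚ, ζ ^ p = 1 → ζ = 1)) ∨
      (∃ (ℓ : ℕ) (_ : Fact ℓ.Prime), ℓ ≠ 2 ∧ (ℓ : 𝓞 ℚ) ∈ v.asIdeal ∧ (p : 𝓞 ℚ) ∉ v.asIdeal ∧
        A.HasMultiplicativeReductionAtPrime ℓ ∧
        (∀ r : v.adicCompletion ℚ, algebraMap ℚ (v.adicCompletion ℚ) (-(A.c₄ / A.c₆)) ≠ r ^ 2) ∧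
        W.HasGoodReductionAt v) ∨
      ((p : 𝓞 ℚ) ∈ v.asIdeal ∧ A.HasMultiplicativeReductionAtPrime p ∧
        (∀ r : v.adicCompletion ℚ, algebraMap ℚ (v.adicCompletion ℚ) (-(A.c₄ / A.c₆)) ≠ r ^ 2) ∧
        W.HasGoodReductionAtPrime p) ∨
      (∃ (ℓ : ℕ) (_ : Fact ℓ.Prime), ℓ ≠ 2 ∧ (ℓ : 𝓞 ℚ) ∈ v.asIdeal ∧ (p : 𝓞 ℚ) ∉ v.asIdeal ∧
        A.HasGoodReductionAt v ∧ W.HasMultiplicativeReductionAtPrime ℓ ∧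
        (∀ r : v.adicCompletion ℚ, algebraMap ℚ (v.adicCompletion ℚ) (-(W.c₄ / W.c₆)) ≠ r ^ 2)))
    (hbudget : ∏ v ∈ T, (Nat.card (nsmulAddMonoidHom p :
        (A.baseChange (v.adicCompletion ℚ)).toAffine.Point →+ _).ker *
      Nat.card (v.adicCompletionIntegers ℚ ⧸
        Ideal.span {(p : v.adicCompletionIntegers ℚ)})) ≤ p) :
    MissingLowerBoundAt W p := by
  haveI : Finite W.toAffine.Point := finite_point_of_analyticRank_eq_zero W hGZK hr
  have hirrA : A.HasIrreducibleModPGaloisRep p :=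
    Mazur1978.hasIrreducibleModPGaloisRep_of_addEquiv θ.symm
      (addEquiv_symm_smul_of_equivariant' A p θ hθ) hirr
  have hSelA := lt_natCard_selmerGroup_of_bsdp_of_padicValRat_pos A p hCT hirrA hbsdA hrA hqA hvA
  have hle := X11a.SelmerCompanion.natCard_selmerGroup_le_of_congr_of_six_kinds_rat A W p hU hU2 hEP
    hp θ hθ S T hTS hS hplaces
  exact Additive.RankZero.missingLowerBoundAt_of_exists_sha_torsion W p hCT hGZK hr hq hv
    (exists_sha_ne_zero_of_natCard_selmerGroup_le_mul W p hle (hbudget.trans_lt hSelA)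
      (coprime_natCard_point_of_irr W p hirr))

/-- **T-X4-ШT-6k, the END — `BSD(E,p)` on X4 ∧ `r_an = 0` ∧ potentially good at an odd `p` from
Kato's UPPER half and a BSD-decided rank-`0` Ш-partner along the SIX KINDS of agreement places.**
As `X4RankZero.bsdp_of_congr_of_shaPartner_of_kato` with `hloc` (`A(ℚ_v)[p] = 0` on all of `S`)
replaced by the six-kinds disjunction on `S \ T` and the lossy budget on `T`. At `p = 3` on the wild
O6 core this is T-X4-ШT-6k of o6-r1 GEN 23 (census C-ШT-1: kinds from reduction types, `t_ℓ` and
`ℓ mod 3`; `T = {3}` with `t₃ = 1`). [cite: Kato2004Asterisque, Thm. 14.5 (3) (p. 236)]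
[cite: MazurRubin2004, §2.3] [cite: SilvermanATAEC1994, Ch. V Thm. 3.1, Thm. 5.3, Cor. 5.4]
[cite: SilvermanAEC2009, Thm. X.4.14] [cite: Miller2011LMS, §1 and Def. 1.1] -/
theorem X4RankZero.bsdp_of_congr_of_shaPartner_of_kato_six_kinds
    (hKato : Kato2004.rankZero_padicValNat_sha_le_of_additive_potGood_of_imageContainsSL2)
    (hCT : exists_casselsTate_pairing (K := ℚ))
    (hGZK : rank_eq_analyticRank_of_analyticRank_le_one) (hmod : hasEntireLFunction_rat)
    (hU : Silverman1994_thmV53_tateUniformisation.{0})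
    (hU2 : Silverman1994_thmV53_corV54_tateUniformisation.{0})
    (hEP : ∀ v : HeightOneSpectrum (𝓞 ℚ), (p : 𝓞 ℚ) ∈ v.asIdeal →
      localEulerPoincareCharacteristic (v.adicCompletion ℚ))
    [W.IsGloballyMinimal] (hp : p ≠ 2)
    (hr : W.analyticRank = 0) (hX : ClassX4 W p) (hpot : 0 ≤ padicValRat p W.j)
    (hsurj : ∀ n : ℕ, W.HasSurjectiveModNGaloisRep (p ^ n : ℕ)) (htam : ¬ p ∣ W.tamagawaProduct)
    {N : ℕ} [NeZero N] (D : ModularParametrizationData W N) (hc : ¬ (p : ℤ) ∣ D.maninConstant)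
    {q : ℚ} (hq : shaAn W = (q : ℂ)) (hv : padicValRat p q ≤ 2)
    (A : WeierstrassCurve ℚ) [A.IsElliptic] [A.IsGloballyMinimal]
    (θ : geomTorsion A (p : ℤ) ≃+ geomTorsion W (p : ℤ))
    (hθ : ∀ (σ : absoluteGaloisGroup ℚ) (P : geomTorsion A (p : ℤ)), θ (σ • P) = σ • θ P)
    (hbsdA : BSDp A p) (hrA : A.analyticRank = 0) {qA : ℚ} (hqA : shaAn A = (qA : ℂ))
    (hvA : 0 < padicValRat p qA) (S T : Finset (HeightOneSpectrum (𝓞 ℚ))) (hTS : T ⊆ S)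
    (hS : ∀ v : HeightOneSpectrum (𝓞 ℚ), v ∉ S →
      W.HasGoodReductionAt v ∧ A.HasGoodReductionAt v ∧ (p : 𝓞 ℚ) ∉ v.asIdeal)
    (hplaces : ∀ v ∈ S, v ∉ T →
      ((p : 𝓞 ℚ) ∉ v.asIdeal ∧ Nat.card (nsmulAddMonoidHom p :
          (A.baseChange (v.adicCompletion ℚ)).toAffine.Point →+ _).ker = 1) ∨
      (W.HasSplitMultiplicativeReductionAt v ∧ A.HasSplitMultiplicativeReductionAt v ∧
        Nat.card (nsmulAddMonoidHom p :
          (W.baseChange (v.adicCompletion ℚ)).toAffine.Point →+ _).ker ≤ p) ∨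
      (W.HasMultiplicativeReductionAt v ∧ A.HasMultiplicativeReductionAt v ∧
        (∃ r : v.adicCompletion ℚ, algebraMap ℚ (v.adicCompletion ℚ) (-(W.c₄ / W.c₆)) =
          r ^ 2 * algebraMap ℚ (v.adicCompletion ℚ) (-(A.c₄ / A.c₆))) ∧
        (∀ ζ : v.adicCompletion ℚ, ζ ^ p = 1 → ζ = 1)) ∨
      (∃ (ℓ : ℕ) (_ : Fact ℓ.Prime), ℓ ≠ 2 ∧ (ℓ : 𝓞 ℚ) ∈ v.asIdeal ∧ (p : 𝓞 ℚ) ∉ v.asIdeal ∧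
        A.HasMultiplicativeReductionAtPrime ℓ ∧
        (∀ r : v.adicCompletion ℚ, algebraMap ℚ (v.adicCompletion ℚ) (-(A.c₄ / A.c₆)) ≠ r ^ 2) ∧
        W.HasGoodReductionAt v) ∨
      ((p : 𝓞 ℚ) ∈ v.asIdeal ∧ A.HasMultiplicativeReductionAtPrime p ∧
        (∀ r : v.adicCompletion ℚ, algebraMap ℚ (v.adicCompletion ℚ) (-(A.c₄ / A.c₆)) ≠ r ^ 2) ∧
        W.HasGoodReductionAtPrime p) ∨
      (∃ (ℓ : ℕ) (_ : Fact ℓ.Prime), ℓ ≠ 2 ∧ (ℓ : 𝓞 ℚ) ∈ v.asIdeal ∧ (p : 𝓞 ℚ) ∉ v.asIdeal ∧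
        A.HasGoodReductionAt v ∧ W.HasMultiplicativeReductionAtPrime ℓ ∧
        (∀ r : v.adicCompletion ℚ, algebraMap ℚ (v.adicCompletion ℚ) (-(W.c₄ / W.c₆)) ≠ r ^ 2)))
    (hbudget : ∏ v ∈ T, (Nat.card (nsmulAddMonoidHom p :
        (A.baseChange (v.adicCompletion ℚ)).toAffine.Point →+ _).ker *
      Nat.card (v.adicCompletionIntegers ℚ ⧸
        Ideal.span {(p : v.adicCompletionIntegers ℚ)})) ≤ p) :
    BSDp W p := by
  have hirr : W.HasIrreducibleModPGaloisRep p :=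
    hasIrreducibleModPGaloisRep_of_hasSurjectiveModNGaloisRep W p (by simpa using hsurj 1)
  exact Additive.X4RankZero.bsdp_of_missingLowerBoundAt_of_kato W p hKato hGZK hmod hr hX hpot hsurj
    htam D hc
    (RankZero.missingLowerBoundAt_of_congr_of_shaPartner_six_kinds W p hCT hGZK hU hU2 hEP hp hr hirr
      hq hv A θ hθ hbsdA hrA hqA hvA S T hTS hS hplaces hbudget)

end SixKinds

end Summit.BirchSwinnertonDyer.Rank1Residual.O6
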